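import Literature.MathematicalPhysics.QuantumFieldTheory.Balaban1983to89.B9Cor35CDirAtCubeField
import Literature.MathematicalPhysics.QuantumFieldTheory.Balaban1983to89.B9Cor35POneAtCubeLetters

/-!
# `Balaban1983to89.B9Cor35PDirAtCubeField` — [Balaban1985BackgroundPropagators] (3.76)–(3.77) pp. 405–406 ∕ COR. 3.5–3.6 pp. 407–408 FOR PRINT's DIRICHLET
# PROJECTION WORD `𝒫_□ = G′_□Q′*_□C_□Q′_□G′_□` (p. 409 l. 1–5, (3.25) p. 394): THEOREM 3.4's `P₁`-CLAUSE AT `U = 1` AT THE SMALL FIELD OF A CUT POTENTIAL, on the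
# Dirichlet carrier `𝔖 × ι`, UNIFORMLY IN THE MEMBER AND THE COVER CUBE — r06's `B9Thm34POneUniformBlk.exists_threshold_pOne_uniform_blk` RUN with every
# `A`-independent binder DISCHARGED, the engine's letters identified with def-Y's (`GpDirK`, `conj b(η²(padΔ_{□,Ω₀}(Ṽ))⁻¹)`, `QcR ∕ QcsR`, `CinvR`) — the
# Dirichlet twin of r05's `B9Cor35POneAtCubeLetters.cor35_POne_cube` (ROAD (I) U6c; seat dag-n06-c g33)

statement-level skeleton of published theorems with citation tags; proofs where landed; nothing here is a claim about the Yang–Mills mass gap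

## What this file does (mathematically)

[Balaban1985BackgroundPropagators] (3.76) p. 405 splits `D_{U′U}𝒫(U′U)D*_{U′U} − D_U𝒫(U)D*_U` into four words, each estimated in (3.77) p. 406 by
`O(α₁)·ℓ(a)^{−2}·e^{−δd}`; Cor. 3.5 ∕ 3.6 pp. 407–408 put this at `U = 1` and the cube sequence's Dirichlet letters.  ★★★ `cor35_PDir_cube`: constants `δ > 0`,
thresholds, `a₁ > 0`, `K ≥ 0` (functions of `d, L, M₂, C_q`) such that for every member above threshold, cover cube `□`, `0 ≤ α₁ ≤ a₁` and vector potential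
`A` with the (3.37)∕(3.59) data of FILE `B9Cor35CDirAtCubeField.cor35_CDir_cube` at the cut potential `Ã = cutFldS Ω₀(□) A`, `Ṽ = cutCfgS Ω₀(□) η A`: the
realified difference of the Dirichlet `P₁`-words on the carrier,
`∇_Ṽ ∘ (G̃ ∘ QcsR Ṽ ∘ CinvR Ṽ ∘ QcR Ṽ ∘ G̃) ∘ ∇*_Ṽ − ∇_1 ∘ (Gp ∘ QcsR 1 ∘ CinvR 1 ∘ QcR 1 ∘ Gp) ∘ ∇*_1` with `Gp = GpDirK` (`= conj b(η²(padΔ_{□,Ω₀}(1))⁻¹)`),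
`G̃ = conj b(η²(padΔ_{□,Ω₀}(Ṽ))⁻¹)`, has the block majorant `K·α₁·ℓ(a)⁻²·e^{−δd(a,a′)}` over `(toB6 (geoCK i □) Rr H, q ↦ blkCubeY(q.1.2))`.

## Status

Printed-statement pass + proof body (proof-backed; a port in the tree's vocabulary; assembly after r05): [Balaban1985BackgroundPropagators] pp. 400–409,
re-read 2026-08-31.  Honest label: (3.77) at the Dirichlet cube letters ON THE CARRIER; the rewriting of the carrier `P`-word `G̃ ∘ QcsR Ṽ ∘ CinvR Ṽ ∘ QcR Ṽ ∘ G̃`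
as def-Y's `PCubeDY i □ parKnit (GpDirY … Ω₀) 𝔖 Ṽ` in print's units is one more bookkeeping identity (sequel); the `A`-dependent data stay hypotheses.  Node
N06 of the `pub-ymgap` DAG is NOT discharged here and the Yang–Mills mass gap is NOT proved here.  NEW file; nothing landed is modified.  No `sorry`, no
`axiom`, no `instance`, no `notation`.  Net new unproved facts: 0.  Cell `pub-ymgap` (HUMAN RULING D-0062), node N06 [B9], seat `pub-ymgap-dag-n06-c` (g33),
2026-08-31.
RELATED, NOT DUPLICATED (searched 2026-08-31: `rg 'cor35_PDir_cube|rep_cornerS_injective|prodCfg_one_chartA_eq_UboxY_cutCfgS'` = ∅): r05 `B9Cor35POneAtCubeLetters`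
(whole torus; its `pOp_sec_eq`, `four_words_eq`, `blkCubeY_corner` USED BY NAME), FILE `B9Cor35CDirAtCubeField` and its inputs (USED BY NAME).
-/

noncomputable section

namespace Literature.MathematicalPhysics.QuantumFieldTheory.Balaban1983to89.B9Cor35PDirAtCubeField

open B6KLevelCensusIndexV1 (KIdx kGeo)
open B6Cover236MultiLevelBlocks (cubes)
open B6RandomWalk (HasMajorant BlockSupp hasMajorant_mono Triangle254 Ineq261 c1_nonneg)
open B6RandomWalkHom (HasMajorantHom hasMajorantHom_mono)
open B6RandomWalkSection (secExt secRes secConj)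
open B6Geom246MultiLevelBoxL0 (blkOf corner corner_mem)
open B9Thm34Ext (toB6)
open B9Ineq347 (ScaleTransfer)
open B9Eq352DivFormLetters (conj)
open B9Eq352GradLetters (diffLetter)
open B9Eq360Vprime (gPrimeExtEnd pPrime pOp)
open B9Eq360VprimeLetters (vPrimeConc)
open B9Eq39Adjoint (covD covDstar prodCfg fluct)
open B9Eq352DivForm (tauB)
open B9Eq376POneLetters (conjHom gradLin divLin)
open B9Thm34POneUniformBlk (exists_threshold_pOne_uniform_blk)
open B9CubeLettersOpsL0 (cubeFamY oddMh)
open B9CubeLettersBondOpsL0 (BlkCubeY qpKc qpsKc QpCubeY QpsCubeY)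
open B9Eq360DeltaPrimeAY (AfldY chartA mulY UboxY_mulY_fluct)
open B9Eq360DeltaPrimeACubeY (blkCubeY kQCubeY sQCubeY kFCubeY sFCubeY)
open B9CubeGeometryInputs (geoCK geoCK_len geoCK_eta geoCK_eta_pos geoCK_len_pos geoCK_eta_le_len geoCK_dist_axioms stencil_geoCK geoCK_site_nonempty hST_geoCK
  exists_h261_geoCK N1 RM1)
open B9Cor35GpCubeInputsAtOne (wK cfunK wK_nonneg card_block_mul_wK_le norm_kQCubeY_one_le norm_sQCubeY_one_le abs_cfunK_le)
open B9Cor35CinvAtCubeLetters (kernel_rate_mono)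
open B9Cor35POneAtCubeLetters (pOp_sec_eq four_words_eq blkCubeY_corner)
open B9Cor36CutoffField337 (UboxY_one)
open B9Cor35GpDirInputsAtOne (dirDomY GpDirK)
open B9Cor35GpDirAtCubeLetters (cor35_GpDir_cube)
open B9Cor36GpDirExtAtField (GextDirK_eq_GpDirVK)
open B9Eq337CutFieldDirY (cutFldS cutCfgS)
open B9Eq360PadDeltaCubeYAgree (compr_sub_compr_eq_cutCfgS)
open B9CubeSequence408Mirrors (mem_dirDomC_of_lev_pos)
open B9Cor35CDirCarrierAtOne (SBlk QcR QcsR CinvR hLinv_CinvR thm32_CinvR)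
open B9Cor35CDirCarrierQLetters (hasMajorantHom_QcR hasMajorantHom_QcsR FcR FcsR QcR_eq_add QcsR_eq_add hasMajorantHom_FcR hasMajorantHom_FcsR)
open B9Cor35CDirPaddedCarrier (eq_CinvR_of_laws)
open B9Cor35CDirWordAtField (word_at)
open Node00 (SiteY CfgY toKT shiftY UboxY)
open Node00.OpsYCubeDirInverse (padDeltaCubeY)
open Node00.OpsYCubeKnitPar (parKnitCubeY parKnitCubeY_one)

variable {d ℓ : ℕ} {hd : 1 ≤ d + 1} {hL : Odd (ℓ + 1) ∧ 1 < ℓ + 1} {b₀ b₁ : ℝ}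
variable {𝔸 : Type} [NormedRing 𝔸] [NormedAlgebra ℂ 𝔸] [CompleteSpace 𝔸]
variable {ι : Type} [Fintype ι] (b : Module.Basis ι ℝ 𝔸)

section Cube

variable (i : KIdx d ℓ hd hL b₀ b₁) (c : ↥(cubes (toKT i).D.toDomains))

omit [NormedRing 𝔸] [NormedAlgebra ℂ 𝔸] [CompleteSpace 𝔸] [Fintype ι] in
/-- the corner section `(s, j) ↦ (corner s, j)` of the CARRIER `𝔖 × ι` into `SiteY i × ι` is injective. [cite: Balaban1984PropagatorsII, (2.45) p.231, bookkeeping] -/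
theorem rep_cornerS_injective :
    Function.Injective (fun p : ↥(SBlk i c) × ι =>
      ((⟨corner (cubeFamY i c).toDomains p.1.1, corner_mem (cubeFamY i c).toDomains p.1.1⟩ : SiteY i), p.2)) := by
  intro p q h
  simp only [Prod.mk.injEq] at h
  obtain ⟨h1, h2⟩ := h
  refine Prod.ext (Subtype.ext ?_) h2
  rw [← blkCubeY_corner i c p.1.1, ← blkCubeY_corner i c q.1.1]
  exact congrArg (blkCubeY i c) h1

/-- `U′·1` with `U′ = e^{iηÃ}` on the chart IS `Ṽ = cutCfgS Ω₀(□) η A` read through `UboxY`. [cite: Balaban1985BackgroundPropagators, Cor. 3.6 p.408, (3.50) p.400, dictionary] -/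
theorem prodCfg_one_chartA_eq_UboxY_cutCfgS (A : AfldY 𝔸 i) :
    prodCfg (fun _ _ => (1 : 𝔸ˣ)) (geoCK i c).eta (chartA i (cutFldS i (dirDomY i c) A)) = UboxY i (cutCfgS i (dirDomY i c) (kGeo i).eta A) := by
  rw [geoCK_eta, cutCfgS, UboxY_mulY_fluct, UboxY_one]

end Cube

set_option maxRecDepth 16384 in
/-- ★★★ **(3.76)–(3.77) ∕ COR. 3.5–3.6 FOR PRINT's DIRICHLET PROJECTION WORD ON THE CARRIER `𝔖 × ι` AT THE SMALL FIELD OF A CUT POTENTIAL, UNIFORMLY IN THE MEMBER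
AND THE COVER CUBE** (see the module doc for the dictionary).
[cite: Balaban1985BackgroundPropagators, (3.76)–(3.77) pp.405–406, (3.68) p.403, (3.25) p.394, Cor. 3.5 p.407, Cor. 3.6 p.408, Thm 3.4 p.400, Thm 3.2 (3.48) p.398, p.409 l.1–5; Balaban1984PropagatorsII, Lemma 2.1 p.234, (2.51)–(2.52) p.232] -/
theorem cor35_PDir_cube [DecidableEq ι] (d ℓ : ℕ) (hℓ : 1 ≤ ℓ) (Cq M₂ : ℝ) (hCq : 0 ≤ Cq) (hM₂ : 0 ≤ M₂) (hrepr : ∀ (v : 𝔸) (j : ι), |b.repr v j| ≤ M₂ * ‖v‖)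
    (h1 : ‖(1 : 𝔸)‖ ≤ 1) :
    ∃ δ M₀ T₀ : ℝ, ∃ N₀ : ℕ, 0 < δ ∧ ∃ a₁ : ℝ, 0 < a₁ ∧ ∃ K : ℝ, 0 ≤ K ∧
    ∀ {hd : 1 ≤ d + 1} {hL : Odd (ℓ + 1) ∧ 1 < ℓ + 1} {b₀ b₁ : ℝ} (i : KIdx d ℓ hd hL b₀ b₁) (c : ↥(cubes (toKT i).D.toDomains)) (Rr : ℝ) (H : Prop),
      M₀ ≤ ((ℓ : ℝ) + 1) * (toKT i).Mh → N₀ + 1 ≤ (toKT i).R * ((ℓ + 1) * (toKT i).Mh) → T₀ ≤ RM1 i →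
    ∀ (α₁ : ℝ), 0 ≤ α₁ → α₁ ≤ a₁ →
    ∀ (A : AfldY 𝔸 i),
      (∀ y x, blkCubeY i c x = y →
        ‖kFCubeY i c (parKnitCubeY i c) (fun _ _ => 1) (cutCfgS i (dirDomY i c) (kGeo i).eta A) y x‖ ≤ Cq * α₁ * wK i c y) →
      (∀ x, ‖sFCubeY i c (parKnitCubeY i c) (fun _ _ => 1) (cutCfgS i (dirDomY i c) (kGeo i).eta A) x‖ ≤ Cq * α₁) →
      (∀ ν k x, ‖(((geoCK i c).eta : ℂ)⁻¹) • covDstar (shiftY i) (fun _ _ => (1 : 𝔸ˣ)) ν (chartA i (cutFldS i (dirDomY i c) A) k) x‖ ≤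
        α₁ * ((geoCK i c).len (blkCubeY i c x) ^ 2)⁻¹) →
      (∀ μ ν x, ‖(((geoCK i c).eta : ℂ)⁻¹) • covD (shiftY i) (fun _ _ => (1 : 𝔸ˣ)) μ (chartA i (cutFldS i (dirDomY i c) A) ν) x‖ ≤
        α₁ * ((geoCK i c).len (blkCubeY i c x) ^ 2)⁻¹) →
      (∀ μ x, ‖(((geoCK i c).eta : ℂ)⁻¹) • covDstar (shiftY i) (fun _ _ => (1 : 𝔸ˣ)) μ
          (tauB (shiftY i) (fun _ _ => (1 : 𝔸ˣ)) μ (chartA i (cutFldS i (dirDomY i c) A) μ)) x‖ ≤ α₁ * ((geoCK i c).len (blkCubeY i c x) ^ 2)⁻¹) →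
      (∀ k x, ‖chartA i (cutFldS i (dirDomY i c) A) k x‖ ≤ α₁ * ((geoCK i c).len (blkCubeY i c x))⁻¹) →
      (∀ ν k x, ‖tauB (shiftY i) (fun _ _ => (1 : 𝔸ˣ)) ν (chartA i (cutFldS i (dirDomY i c) A) k) x‖ ≤ α₁ * ((geoCK i c).len (blkCubeY i c x))⁻¹) →
      (∀ z w : SiteY i, ‖(parKnitCubeY i c (cutCfgS i (dirDomY i c) (kGeo i).eta A) z w : 𝔸)‖ ≤ 1 ∧
        ‖(((parKnitCubeY i c (cutCfgS i (dirDomY i c) (kGeo i).eta A) z w)⁻¹ : 𝔸ˣ) : 𝔸)‖ ≤ 1) →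
      (∀ (s : BlkCubeY i c) (lam : SiteY i → 𝔸),
        ‖(QpCubeY i c (parKnitCubeY i c) (cutCfgS i (dirDomY i c) (kGeo i).eta A) lam - QpCubeY i c (parKnitCubeY i c) (fun _ _ => 1) lam) s‖ ≤
          Cq * α₁ * ∑ z, |qpKc i c s z| * ‖lam z‖) →
      (∀ (z : SiteY i) (nu : BlkCubeY i c → 𝔸),
        ‖(QpsCubeY i c (parKnitCubeY i c) (cutCfgS i (dirDomY i c) (kGeo i).eta A) nu - QpsCubeY i c (parKnitCubeY i c) (fun _ _ => 1) nu) z‖ ≤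
          Cq * α₁ * ∑ s, |qpsKc i c z s| * ‖nu s‖) →
      HasMajorant (g := toB6 (geoCK i c) Rr H) (fun q : (Fin (d + 1) × SiteY i) × ι => blkCubeY i c q.1.2)
        (conjHom b (gradLin (shiftY i) (((geoCK i c).eta : ℂ)⁻¹) (UboxY i (cutCfgS i (dirDomY i c) (kGeo i).eta A))) ∘ₗ
            (conj b (((kGeo i).eta ^ 2) • (Ring.inverse (padDeltaCubeY i c (parKnitCubeY i c) (dirDomY i c) (cutCfgS i (dirDomY i c) (kGeo i).eta A))).restrictScalars ℝ) ∘ₗ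
              QcsR b i c (cutCfgS i (dirDomY i c) (kGeo i).eta A) ∘ₗ CinvR b i c (cutCfgS i (dirDomY i c) (kGeo i).eta A) ∘ₗ
              QcR b i c (cutCfgS i (dirDomY i c) (kGeo i).eta A) ∘ₗ
              conj b (((kGeo i).eta ^ 2) • (Ring.inverse (padDeltaCubeY i c (parKnitCubeY i c) (dirDomY i c) (cutCfgS i (dirDomY i c) (kGeo i).eta A))).restrictScalars ℝ)) ∘ₗ
            conjHom b (divLin (shiftY i) (((geoCK i c).eta : ℂ)⁻¹) (UboxY i (cutCfgS i (dirDomY i c) (kGeo i).eta A))) -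
          conjHom b (gradLin (shiftY i) (((geoCK i c).eta : ℂ)⁻¹) (fun _ _ => (1 : 𝔸ˣ))) ∘ₗ
            (GpDirK b i c (parKnitCubeY i c) ∘ₗ QcsR b i c (fun _ _ => 1) ∘ₗ CinvR b i c (fun _ _ => 1) ∘ₗ QcR b i c (fun _ _ => 1) ∘ₗ
              GpDirK b i c (parKnitCubeY i c)) ∘ₗ
            conjHom b (divLin (shiftY i) (((geoCK i c).eta : ℂ)⁻¹) (fun _ _ => (1 : 𝔸ˣ))))
        (fun a a' => K * α₁ * ((geoCK i c).len a ^ 2)⁻¹ * Real.exp (-(δ * (geoCK i c).dist a a'))) := by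
  classical
  have hSb : 0 ≤ ∑ j, ‖b j‖ := Finset.sum_nonneg fun j _ => norm_nonneg _
  -- UNIT 2: Theorem 3.1 for `GpDirK` (all orientations) and the word laws; U6b-i: Theorem 3.2 for `CinvR 1`
  obtain ⟨δG, BG, MG, TG, NG, hδG, hBG, aG, haG, BB, -, hG⟩ := cor35_GpDir_cube b d ℓ hℓ Cq M₂ hCq hM₂ hrepr h1
  obtain ⟨δ₂, C₂, M₂', hδ₂, hC₂, -, h32⟩ := thm32_CinvR b d ℓ hℓ
  set δ₀ : ℝ := min δG δ₂ with hδ₀def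
  have hδ₀ : 0 < δ₀ := lt_min hδG hδ₂
  have hδ₀1 : δ₀ ≤ δG := min_le_left _ _
  have hδ₀2 : δ₀ ≤ δ₂ := min_le_right _ _
  obtain ⟨dB, h261⟩ := exists_h261_geoCK d ℓ hδ₀
  have hΛf : ∀ α : ℝ, 0 < α → (1 : ℝ) ≤ ((ℓ : ℝ) + 1) ^ 4 := fun α _ =>
    one_le_pow₀ (by linarith [(Nat.cast_nonneg ℓ : (0 : ℝ) ≤ ℓ)])
  set κQ : ℝ := M₂ * (∑ j, ‖b j‖) + 1 with hκQdef
  have hκQ : 0 < κQ := by rw [hκQdef]; nlinarith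
  set cF : ℝ := M₂ * (∑ j, ‖b j‖) * Cq + 1 with hcFdef
  have hcF : 0 < cF := by rw [hcFdef]; nlinarith [mul_nonneg (mul_nonneg hM₂ hSb) hCq]
  obtain ⟨aP, haP, K, hK, H34⟩ := exists_threshold_pOne_uniform_blk b (Fin (d + 1)) dB δ₀ κQ BG C₂ cF Cq 1 1 M₂ (fun _ => ((ℓ : ℝ) + 1) ^ 4)
    hκQ hBG hC₂ hcF hCq zero_le_one hM₂ hδ₀ hΛf hrepr
  refine ⟨1 / 5 * δ₀, max M₂' MG, max (4 * Real.log ((ℓ : ℝ) + 1) / (9 / 5000 * δ₀)) TG, max (N1 d ℓ (9 / 5000 * δ₀)) NG, by positivity,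
    min aG aP, lt_min haG haP, K, hK, ?_⟩
  intro hd hL b₀ b₁ i c Rr H hM hN hT α₁ hα0 hα1 A hkF hsF h337B h337F h337Bτ hA hAτB hparV hF hFs
  -- thresholds
  have hM2 : M₂' ≤ ((ℓ : ℝ) + 1) * (toKT i).Mh := (le_max_left _ _).trans hM
  have hMG : MG ≤ ((ℓ : ℝ) + 1) * (toKT i).Mh := (le_max_right _ _).trans hM
  have hN2 : N1 d ℓ (9 / 5000 * δ₀) + 1 ≤ (toKT i).R * ((ℓ + 1) * (toKT i).Mh) := le_trans (Nat.succ_le_succ (le_max_left _ _)) hN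
  have hNG : NG + 1 ≤ (toKT i).R * ((ℓ + 1) * (toKT i).Mh) := le_trans (Nat.succ_le_succ (le_max_right _ _)) hN
  have hT2 : 4 * Real.log ((ℓ : ℝ) + 1) / (9 / 5000 * δ₀) ≤ RM1 i := (le_max_left _ _).trans hT
  have hTG : TG ≤ RM1 i := (le_max_right _ _).trans hT
  -- UNIT 2 at the knit cube legs: (b), (c) and the word laws (d) at the cut potential; n06-a: the `G`-word is the padded inverse at `Ṽ`
  obtain ⟨-, e1, e2, e3, hrest⟩ := hG i c Rr H (parKnitCubeY i c) (parKnitCubeY_one i c) hMG hNG hTG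
  obtain ⟨hw1, hw2, -, -⟩ := hrest α₁ hα0 (hα1.trans (min_le_left _ _)) (chartA i (cutFldS i (dirDomY i c) A))
    (kFCubeY i c (parKnitCubeY i c) (fun _ _ => 1) (cutCfgS i (dirDomY i c) (kGeo i).eta A))
    (sFCubeY i c (parKnitCubeY i c) (fun _ _ => 1) (cutCfgS i (dirDomY i c) (kGeo i).eta A)) hkF hsF h337B h337F h337Bτ hA hAτB
  have hS1 : ∀ z : SiteY i, 1 ≤ B9CubeLettersOpsL0.levCubeY i c z → z ∈ dirDomY i c := fun z hz =>
    mem_dirDomC_of_lev_pos hL.1 (oddMh i) (toKT i).hMh (toKT i).hP c hz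
  obtain ⟨hunit, hGext⟩ := GextDirK_eq_GpDirVK b i c (parKnitCubeY i c) A (compr_sub_compr_eq_cutCfgS i c hS1 (kGeo i).eta A) hw1 hw2
  have hGw := hGext
  unfold B9Cor36GpDirExtAtField.GextDirK B9Cor36GpDirExtAtField.VpDirK B9Cor36GpDirExtAtField.GpDirVK at hGw
  -- geometry of the cube sequence (r05 FILE 5a)
  haveI : Nonempty (geoCK i c).Site := geoCK_site_nonempty i c
  obtain ⟨hdnn, htri, hrefl, hsym⟩ := geoCK_dist_axioms i c Rr H
  obtain ⟨hd₀B, hd₀F, hd₀0⟩ := stencil_geoCK i c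
  -- Theorem 3.1 (3.42)₁,₂,₃ for `GpDirK` at the rate `δ₀`
  have g342_1 : HasMajorant (g := toB6 (geoCK i c) Rr H) (fun p : SiteY i × ι => blkCubeY i c p.1) (GpDirK b i c (parKnitCubeY i c))
      (fun a a' => BG * (geoCK i c).len a ^ 2 * Real.exp (-(δ₀ * (geoCK i c).dist a a'))) :=
    hasMajorant_mono (g := toB6 (geoCK i c) Rr H) _ e1 fun a a' => kernel_rate_mono hdnn hδ₀1 (mul_nonneg hBG.le (sq_nonneg _)) a a'
  have g342_2 : ∀ k : Fin (d + 1) ⊕ Fin (d + 1), HasMajorant (g := toB6 (geoCK i c) Rr H) (fun p : SiteY i × ι => blkCubeY i c p.1)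
      (conj b (diffLetter (shiftY i) (fun _ _ => (1 : 𝔸ˣ)) ((((geoCK i c).eta : ℂ))⁻¹) k) * GpDirK b i c (parKnitCubeY i c))
      (fun a a' => BG * (geoCK i c).len a * Real.exp (-(δ₀ * (geoCK i c).dist a a'))) := fun k =>
    hasMajorant_mono (g := toB6 (geoCK i c) Rr H) _ (e2 k) fun a a' => kernel_rate_mono hdnn hδ₀1 (mul_nonneg hBG.le (geoCK_len_pos i c a).le) a a'
  have g342_3 : ∀ k : Fin (d + 1) ⊕ Fin (d + 1), HasMajorant (g := toB6 (geoCK i c) Rr H) (fun p : SiteY i × ι => blkCubeY i c p.1)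
      (GpDirK b i c (parKnitCubeY i c) * conj b (diffLetter (shiftY i) (fun _ _ => (1 : 𝔸ˣ)) ((((geoCK i c).eta : ℂ))⁻¹) k))
      (fun a a' => BG * (geoCK i c).len a * Real.exp (-(δ₀ * (geoCK i c).dist a a'))) := fun k =>
    hasMajorant_mono (g := toB6 (geoCK i c) Rr H) _ (e3 k) fun a a' => kernel_rate_mono hdnn hδ₀1 (mul_nonneg hBG.le (geoCK_len_pos i c a).le) a a'
  -- the (3.19) letters at `U = 1` on the carrier
  have hκle : M₂ * (∑ j, ‖b j‖) ≤ κQ := by rw [hκQdef]; linarith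
  have hpar1 : ∀ z w : SiteY i, ‖((parKnitCubeY i c (fun _ _ => 1) z w : 𝔸ˣ) : 𝔸)‖ ≤ 1 ∧
      ‖(((parKnitCubeY i c (fun _ _ => 1) z w)⁻¹ : 𝔸ˣ) : 𝔸)‖ ≤ 1 := fun z w => by
    rw [parKnitCubeY_one i c z w, inv_one, Units.val_one]; exact ⟨h1, h1⟩
  have hQc := hasMajorantHom_mono (g := toB6 (geoCK i c) Rr H) _ _
    (hasMajorantHom_QcR b i c (fun _ _ => 1) (Rr := Rr) (Hp := H) hpar1 hM₂ hrepr)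
    (K' := fun a a' : BlkCubeY i c => κQ * (if a = a' then (1 : ℝ) else 0)) fun a a' => by
      split_ifs
      · rw [mul_one]; exact hκle
      · rw [mul_zero]
  have hQcs := hasMajorantHom_mono (g := toB6 (geoCK i c) Rr H) _ _
    (hasMajorantHom_QcsR b i c (fun _ _ => 1) (Rr := Rr) (Hp := H) hpar1 hM₂ hrepr)
    (K' := fun a a' : BlkCubeY i c => κQ * (if a = a' then (1 : ℝ) else 0)) fun a a' => by
      split_ifs
      · rw [mul_one]; exact hκle
      · rw [mul_zero]
  -- Theorem 3.2 at `U = 1` on the carrier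
  have hLinv := hLinv_CinvR b i c
  have h348 : HasMajorant (g := toB6 (geoCK i c) Rr H) (fun q : ↥(SBlk i c) × ι => (q.1 : BlkCubeY i c)) (CinvR b i c (fun _ _ => 1))
      (fun a a' => C₂ * (geoCK i c).len a ^ (-(4 : ℝ)) * Real.exp (-(δ₀ * (geoCK i c).dist a a'))) :=
    hasMajorant_mono (g := toB6 (geoCK i c) Rr H) _ (h32 i c Rr H hM2)
      fun a a' => kernel_rate_mono hdnn hδ₀2 (mul_nonneg hC₂.le (Real.rpow_nonneg (geoCK_len_pos i c a).le _)) a a'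
  -- the (3.57) letters on the carrier
  have hcle : M₂ * (∑ j, ‖b j‖) * (Cq * α₁) ≤ cF * α₁ := by
    rw [hcFdef]; nlinarith [mul_nonneg (mul_nonneg hM₂ hSb) hCq]
  have hFc := hasMajorantHom_mono (g := toB6 (geoCK i c) Rr H) _ _
    (hasMajorantHom_FcR b i c (cutCfgS i (dirDomY i c) (kGeo i).eta A) (Rr := Rr) (Hp := H) hM₂ hrepr (by positivity) hF)
    (K' := fun a a' : BlkCubeY i c => cF * α₁ * (if a = a' then (1 : ℝ) else 0)) fun a a' => by
      split_ifs
      · rw [mul_one]; exact hcle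
      · rw [mul_zero]
  have hFcs := hasMajorantHom_mono (g := toB6 (geoCK i c) Rr H) _ _
    (hasMajorantHom_FcsR b i c (cutCfgS i (dirDomY i c) (kGeo i).eta A) (Rr := Rr) (Hp := H) hM₂ hrepr (by positivity) hFs)
    (K' := fun a a' : BlkCubeY i c => cF * α₁ * (if a = a' then (1 : ℝ) else 0)) fun a a' => by
      split_ifs
      · rw [mul_one]; exact hcle
      · rw [mul_zero]
  -- the corner section of the carrier
  have hrep : ∀ p : ↥(SBlk i c) × ι,
      blkCubeY i c ((fun p : ↥(SBlk i c) × ι =>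
        ((⟨corner (cubeFamY i c).toDomains p.1.1, corner_mem (cubeFamY i c).toDomains p.1.1⟩ : SiteY i), p.2)) p).1 = (p.1 : BlkCubeY i c) :=
    fun p => blkCubeY_corner i c p.1.1
  -- r06's `P₁`-clause on the Dirichlet carrier
  obtain ⟨Tinv, hT1, hT2, hTm⟩ := H34 (shiftY i) (fun _ _ => (1 : 𝔸ˣ)) (g := geoCK i c) (Rr := Rr) (H := H) (blkCubeY i c)
    (kQCubeY i c (parKnitCubeY i c) (fun _ _ => 1)) (sQCubeY i c (parKnitCubeY i c) (fun _ _ => 1)) (cfunK i c) (wK i c)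
    hdnn htri hrefl hsym (geoCK_len_pos i c) (geoCK_eta_le_len i c) (geoCK_eta_pos i c)
    (fun α hα hα1 => h261 i c Rr H hN2 α hα hα1.le) (hST_geoCK i c hδ₀ hT2)
    (fun _ _ => ⟨h1, by rw [inv_one, Units.val_one]; exact h1⟩) hd₀B hd₀F hd₀0 (wK_nonneg i c) (card_block_mul_wK_le i c)
    (fun y x hx => by rw [← hx]; exact norm_kQCubeY_one_le i c (parKnitCubeY i c) h1 (parKnitCubeY_one i c) _ x)
    (norm_sQCubeY_one_le i c (parKnitCubeY i c) h1 (parKnitCubeY_one i c)) (abs_cfunK_le i c)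
    g342_1 g342_2 g342_3 (fun q : ↥(SBlk i c) × ι => (q.1 : BlkCubeY i c)) _ hrep (rep_cornerS_injective i c) hQc hQcs hLinv h348
    α₁ hα0 (hα1.trans (min_le_right _ _)) (chartA i (cutFldS i (dirDomY i c) A))
    (kFCubeY i c (parKnitCubeY i c) (fun _ _ => 1) (cutCfgS i (dirDomY i c) (kGeo i).eta A))
    (sFCubeY i c (parKnitCubeY i c) (fun _ _ => 1) (cutCfgS i (dirDomY i c) (kGeo i).eta A))
    hkF hsF h337B h337F h337Bτ hA hAτB (QcR_eq_add b i c _) (QcsR_eq_add b i c _) hFc hFcs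
  -- identify the engine's inverse `Tinv` with `CinvR Ṽ` and the engine's `G`-word with the padded inverse at `Ṽ`
  rw [hGw, word_at b i c _ hunit] at hT1 hT2
  obtain ⟨-, hTinv⟩ := eq_CinvR_of_laws b i c _ hT1 hT2
  rw [hGw, hTinv, prodCfg_one_chartA_eq_UboxY_cutCfgS, pPrime, pOp_sec_eq (rep_cornerS_injective i c), pOp_sec_eq (rep_cornerS_injective i c),
    four_words_eq] at hTm
  exact hTm

end Literature.MathematicalPhysics.QuantumFieldTheory.Balaban1983to89.B9Cor35PDirAtCubeField
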